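import Mathlib
import Literature.Computability.AlgebraicComplexity.GroupTheoreticMatMul
import Literature.Combinatorics.Additive.TightTriangleRemovalProofs

/-!
# SUB-punctured frames: any three sets on the punctured axes of `K₁ × K₂ × K₃` give an STPP pair, and every
# abelian group containing a frame `K₁ ⊕ K₂ ⊕ K₃` with `|Kᵢ| ≥ sᵢ + 1` hosts an STPP pair `(s₁,s₂,s₃) + (s₂,s₃,s₁)`
# (cell mm-stpp, eng-1 g7)

The CKSU punctured pair (`AbelianSTPPCensusPuncturedSubgroupsPair.lean`, this seat g6) takes `P₀ = K₁∖0`,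
`P₁ = K₂∖0`, `P₂ = K₃∖0` on the three axes.  Its proof reads only the zero / non-zero pattern of coordinates,
so it holds verbatim for arbitrary SUBSETS of the punctured axes (`isSTPP_subPunctured_pair`: membership
hypotheses are one-directional).  Consequences: `K₁ × K₂ × K₃` hosts an STPP pair of shapes
`(s₁,s₂,s₃), (s₂,s₃,s₁)` for all `sᵢ ≤ |Kᵢ| − 1` (`exists_isSTPP_subPunctured_pair`), and so does every
abelian group `G` receiving an injective additive map from `K₁ × K₂ × K₃` (`exists_isSTPP_pair_of_frame`, via
`IsSTPP.image`).  This is the EXISTENCE half of the cell's «frame» reading of the pair table (memo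
`mm-stpp-eng-1/psv3/EXACT2-RESULT.md`): e.g. `(3,3,3)²` at order 80 in `ℤ/4 ⊕ ℤ/4 ⊕ ℤ/5`,
`ℤ/4 ⊕ (ℤ/2)² ⊕ ℤ/5`, `(ℤ/2)² ⊕ (ℤ/2)² ⊕ ℤ/5` (exactly the three hosts of order 80 found by the exact engine),
`(6,6,6)²` in the CYCLIC group `ℤ/504 ≅ ℤ/7 ⊕ ℤ/8 ⊕ ℤ/9` (`504 < 3·6³`), the fat pairs
`(7,7,6) + (7,6,7)` in `ℤ/8 ⊕ ℤ/9 ⊕ ℤ/7` and `(8,6,6) + (6,6,8)` in `ℤ/10 ⊕ ℤ/7 ⊕ ℤ/7 ≤ ℤ/70 × ℤ/7`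
(order 490).  It also records that the frame condition in the cell's conjecture (FP*) must read
`|Kᵢ| ≥ sᵢ + 1`, not `=`.
WHAT THIS IS NOT: no `ω` statement; existence only (upper ends); no census number.
-/

-- single-conjunct summit: the mandated namespace repeats `MatrixMultiplication`.
set_option linter.dupNamespace false

namespace Summit.MatrixMultiplication.MatrixMultiplication.Theorems.STPPSubPuncturedPair

open Finset
open Literature.Computability.AlgebraicComplexity (IsSTPP)

variable {K₁ K₂ K₃ : Type*} [AddCommGroup K₁] [AddCommGroup K₂] [AddCommGroup K₃]
  {P₀ P₁ P₂ : Finset (K₁ × K₂ × K₃)}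

/-- **Sub-punctured axes give an STPP pair.**  If `P₀ ⊆ (K₁∖0) × 0 × 0`, `P₁ ⊆ 0 × (K₂∖0) × 0`,
`P₂ ⊆ 0 × 0 × (K₃∖0)` then `![P₀, P₁] ![P₁, P₂] ![P₂, P₀]` is `IsSTPP` (same case analysis as the tree's
`isSTPP_puncturedAxes_pair` / this seat's `…puncturedSubgroups_pair`: each cross pattern has a coordinate in
which exactly one of the six elements survives, and it is non-zero). [cite: CohnKleinbergSzegedyUmans2005, Prop. 5.2] -/
theorem isSTPP_subPunctured_pair
    (hP₀ : ∀ v ∈ P₀, v.1 ≠ 0 ∧ v.2.1 = 0 ∧ v.2.2 = 0)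
    (hP₁ : ∀ v ∈ P₁, v.2.1 ≠ 0 ∧ v.1 = 0 ∧ v.2.2 = 0)
    (hP₂ : ∀ v ∈ P₂, v.2.2 ≠ 0 ∧ v.1 = 0 ∧ v.2.1 = 0) :
    IsSTPP ![P₀, P₁] ![P₁, P₂] ![P₂, P₀] := by
  intro i j k s hs s' hs' t ht t' ht' u hu u' hu' h0
  have h1 := congrArg Prod.fst h0
  have h2 := congrArg (fun v => v.2.1) h0
  have h3 := congrArg (fun v => v.2.2) h0
  simp only [Prod.fst_add, Prod.fst_sub, Prod.snd_add, Prod.snd_sub, Prod.fst_zero, Prod.snd_zero]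
    at h1 h2 h3
  fin_cases i <;> fin_cases j <;> fin_cases k <;>
    simp only [Fin.zero_eta, Fin.mk_one, Fin.isValue, Matrix.cons_val_zero,
      Matrix.cons_val_one] at hs hs' ht ht' hu hu'
  · -- (0,0,0)
    obtain ⟨-, hs2, hs3⟩ := hP₀ _ hs; obtain ⟨-, hs'2, hs'3⟩ := hP₀ _ hs'
    obtain ⟨-, ht1, ht3⟩ := hP₁ _ ht; obtain ⟨-, ht'1, ht'3⟩ := hP₁ _ ht'
    obtain ⟨-, hu1, hu2⟩ := hP₂ _ hu; obtain ⟨-, hu'1, hu'2⟩ := hP₂ _ hu'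
    rw [ht1, ht'1, hu1, hu'1] at h1
    rw [hs2, hs'2, hu2, hu'2] at h2
    rw [hs3, hs'3, ht3, ht'3] at h3
    simp only [sub_self, add_zero, zero_add, sub_eq_zero] at h1 h2 h3
    refine ⟨rfl, rfl, Prod.ext ?_ (Prod.ext ?_ ?_), Prod.ext ?_ (Prod.ext ?_ ?_),
      Prod.ext ?_ (Prod.ext ?_ ?_)⟩
    · exact h1.symm
    · rw [hs2, hs'2]
    · rw [hs3, hs'3]
    · rw [ht1, ht'1]
    · exact h2.symm
    · rw [ht3, ht'3]
    · rw [hu1, hu'1]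
    · rw [hu2, hu'2]
    · exact h3.symm
  · -- (0,0,1): coordinate 2 sees only `u`
    exfalso; apply (hP₂ _ hu).1
    rw [(hP₀ _ hs').2.2, (hP₁ _ hs).2.2, (hP₁ _ ht').2.2, (hP₁ _ ht).2.2, (hP₀ _ hu').2.2] at h3
    simpa using h3
  · -- (0,1,0): coordinate 1 sees only `t`
    exfalso; apply (hP₁ _ ht).1
    rw [(hP₀ _ hs').2.1, (hP₀ _ hs).2.1, (hP₂ _ ht').2.2, (hP₂ _ hu').2.2, (hP₀ _ hu).2.1] at h2
    simpa using h2
  · -- (0,1,1): coordinate 2 sees only `t'`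
    exfalso; apply (hP₂ _ ht').1
    rw [(hP₀ _ hs').2.2, (hP₁ _ hs).2.2, (hP₁ _ ht).2.2, (hP₀ _ hu').2.2, (hP₀ _ hu).2.2] at h3
    simpa using h3
  · -- (1,0,0): coordinate 0 sees only `s`
    exfalso; apply (hP₀ _ hs).1
    rw [(hP₁ _ hs').2.1, (hP₁ _ ht').2.1, (hP₂ _ ht).2.1, (hP₂ _ hu').2.1, (hP₂ _ hu).2.1] at h1
    simpa using h1
  · -- (1,0,1): coordinate 0 sees only `u'`
    exfalso; apply (hP₀ _ hu').1
    rw [(hP₁ _ hs').2.1, (hP₁ _ hs).2.1, (hP₁ _ ht').2.1, (hP₂ _ ht).2.1, (hP₂ _ hu).2.1] at h1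
    simpa using h1
  · -- (1,1,0): coordinate 1 sees only `s'`
    exfalso; apply (hP₁ _ hs').1
    rw [(hP₀ _ hs).2.1, (hP₂ _ ht').2.2, (hP₂ _ ht).2.2, (hP₂ _ hu').2.2, (hP₀ _ hu).2.1] at h2
    simpa using h2
  · -- (1,1,1)
    obtain ⟨-, hs1, hs3⟩ := hP₁ _ hs; obtain ⟨-, hs'1, hs'3⟩ := hP₁ _ hs'
    obtain ⟨-, ht1, ht2⟩ := hP₂ _ ht; obtain ⟨-, ht'1, ht'2⟩ := hP₂ _ ht'
    obtain ⟨-, hu2, hu3⟩ := hP₀ _ hu; obtain ⟨-, hu'2, hu'3⟩ := hP₀ _ hu'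
    rw [hs1, hs'1, ht1, ht'1] at h1
    rw [ht2, ht'2, hu2, hu'2] at h2
    rw [hs3, hs'3, hu3, hu'3] at h3
    simp only [sub_self, add_zero, zero_add, sub_eq_zero] at h1 h2 h3
    refine ⟨rfl, rfl, Prod.ext ?_ (Prod.ext ?_ ?_), Prod.ext ?_ (Prod.ext ?_ ?_),
      Prod.ext ?_ (Prod.ext ?_ ?_)⟩
    · rw [hs1, hs'1]
    · exact h2.symm
    · rw [hs3, hs'3]
    · rw [ht1, ht'1]
    · rw [ht2, ht'2]
    · exact h3.symm
    · exact h1.symm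
    · rw [hu2, hu'2]
    · rw [hu3, hu'3]

/-- **Every `K₁ × K₂ × K₃` with `sᵢ + 1 ≤ |Kᵢ|` hosts an STPP pair of shapes `(s₁,s₂,s₃), (s₂,s₃,s₁)`**
(choose `sᵢ` non-zero elements on each axis). [original] -/
theorem exists_isSTPP_subPunctured_pair [Fintype K₁] [Fintype K₂] [Fintype K₃]
    [DecidableEq K₁] [DecidableEq K₂] [DecidableEq K₃] {s₁ s₂ s₃ : ℕ}
    (h₁ : s₁ + 1 ≤ Fintype.card K₁) (h₂ : s₂ + 1 ≤ Fintype.card K₂) (h₃ : s₃ + 1 ≤ Fintype.card K₃) :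
    ∃ A B C : Fin 2 → Finset (K₁ × K₂ × K₃), IsSTPP A B C ∧
      (A 0).card = s₁ ∧ (B 0).card = s₂ ∧ (C 0).card = s₃ ∧
      (A 1).card = s₂ ∧ (B 1).card = s₃ ∧ (C 1).card = s₁ := by
  classical
  -- `sᵢ` non-zero elements of `Kᵢ`
  obtain ⟨X₁, hX₁, cX₁⟩ := exists_subset_card_eq (n := s₁) (s := (univ : Finset K₁).erase 0)
    (by rw [card_erase_of_mem (mem_univ _), card_univ]; omega)
  obtain ⟨X₂, hX₂, cX₂⟩ := exists_subset_card_eq (n := s₂) (s := (univ : Finset K₂).erase 0)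
    (by rw [card_erase_of_mem (mem_univ _), card_univ]; omega)
  obtain ⟨X₃, hX₃, cX₃⟩ := exists_subset_card_eq (n := s₃) (s := (univ : Finset K₃).erase 0)
    (by rw [card_erase_of_mem (mem_univ _), card_univ]; omega)
  let P₀ : Finset (K₁ × K₂ × K₃) := X₁.image fun x => (x, (0 : K₂), (0 : K₃))
  let P₁ : Finset (K₁ × K₂ × K₃) := X₂.image fun y => ((0 : K₁), y, (0 : K₃))
  let P₂ : Finset (K₁ × K₂ × K₃) := X₃.image fun z => ((0 : K₁), (0 : K₂), z)
  have hP₀ : ∀ v ∈ P₀, v.1 ≠ 0 ∧ v.2.1 = 0 ∧ v.2.2 = 0 := by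
    intro v hv
    obtain ⟨x, hx, rfl⟩ := mem_image.1 hv
    exact ⟨(mem_erase.1 (hX₁ hx)).1, rfl, rfl⟩
  have hP₁ : ∀ v ∈ P₁, v.2.1 ≠ 0 ∧ v.1 = 0 ∧ v.2.2 = 0 := by
    intro v hv
    obtain ⟨y, hy, rfl⟩ := mem_image.1 hv
    exact ⟨(mem_erase.1 (hX₂ hy)).1, rfl, rfl⟩
  have hP₂ : ∀ v ∈ P₂, v.2.2 ≠ 0 ∧ v.1 = 0 ∧ v.2.1 = 0 := by
    intro v hv
    obtain ⟨z, hz, rfl⟩ := mem_image.1 hv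
    exact ⟨(mem_erase.1 (hX₃ hz)).1, rfl, rfl⟩
  have c0 : P₀.card = s₁ := by
    rw [card_image_of_injective _ (fun x y hxy => by simpa using congrArg Prod.fst hxy), cX₁]
  have c1 : P₁.card = s₂ := by
    rw [card_image_of_injective _ (fun x y hxy => by simpa using congrArg (fun v => v.2.1) hxy), cX₂]
  have c2 : P₂.card = s₃ := by
    rw [card_image_of_injective _ (fun x y hxy => by simpa using congrArg (fun v => v.2.2) hxy), cX₃]
  exact ⟨![P₀, P₁], ![P₁, P₂], ![P₂, P₀], isSTPP_subPunctured_pair hP₀ hP₁ hP₂,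
    by simpa using c0, by simpa using c1, by simpa using c2, by simpa using c1, by simpa using c2,
    by simpa using c0⟩

/-- **Every abelian group containing a frame hosts the pair.**  If `G` receives an injective additive
homomorphism from `K₁ × K₂ × K₃` with `sᵢ + 1 ≤ |Kᵢ|`, then `G` hosts an STPP pair of shapes
`(s₁,s₂,s₃), (s₂,s₃,s₁)` (transport by `IsSTPP.image`). [original] -/
theorem exists_isSTPP_pair_of_frame {G : Type*} [AddCommGroup G] [DecidableEq G]
    [Fintype K₁] [Fintype K₂] [Fintype K₃] [DecidableEq K₁] [DecidableEq K₂] [DecidableEq K₃]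
    (f : K₁ × K₂ × K₃ →+ G) (hf : Function.Injective f) {s₁ s₂ s₃ : ℕ}
    (h₁ : s₁ + 1 ≤ Fintype.card K₁) (h₂ : s₂ + 1 ≤ Fintype.card K₂) (h₃ : s₃ + 1 ≤ Fintype.card K₃) :
    ∃ A B C : Fin 2 → Finset G, IsSTPP A B C ∧
      (A 0).card = s₁ ∧ (B 0).card = s₂ ∧ (C 0).card = s₃ ∧
      (A 1).card = s₂ ∧ (B 1).card = s₃ ∧ (C 1).card = s₁ := by
  obtain ⟨A, B, C, hS, a0, b0, c0, a1, b1, c1⟩ := exists_isSTPP_subPunctured_pair h₁ h₂ h₃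
  refine ⟨fun i => (A i).image f, fun i => (B i).image f, fun i => (C i).image f, hS.image f hf,
    ?_, ?_, ?_, ?_, ?_, ?_⟩ <;>
    simp only [card_image_of_injective _ hf, a0, b0, c0, a1, b1, c1]

end Summit.MatrixMultiplication.MatrixMultiplication.Theorems.STPPSubPuncturedPair
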